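import Summits.CriticalPhenomena.PercolationContinuityZ3.Theorems.PercNearOneGluingNoHeavyQuantSliceClosure
import Summits.CriticalPhenomena.PercolationContinuityZ3.Theorems.PercNearOneGluingNoHeavyQuantSDECBlobs
import HarnessLib

/-!
# QUANT lane R8, T-DEC: THE GLUED PAIR `R^a[q](R^b[s])` IS A SAME-MEAN MIXTURE OF TWO INDEPENDENT-BLOB LAWS EXACTLY WHEN IT HAS
# SLACK ABOVE THE FLOOR (`b·(qs − x) ≥ a·(1 − q)`) OR A LIGHT ROOT (`q(a + bs) ≤ a`) — the closed form of 'blob-reducible at the group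
# floor' for the lane's glued-root siblings, as explicit LAW IDENTITIES with gates in `[x,1]` (the `InBlobHull` wrappers are two-line corollaries)

builds on p205010 (kernel theorem, internal audit signed; external expert review pending)

Support file (`--supports stmt-CriticalPhenomena-4575`), QUANT lane lead seat prim-quant-lead (gen 46), rung R8 of
`run/shared/lean/prim/quant/LADDER.md`; memo `run/shared/lean/prim/quant/prim-quant-lead-g46/LEAD-NOTES-G46.md` E2/E6/E9.
Theorems only, standard axioms, no sorries, no definitions.  Imports only census-2 g53's blob bookkeeping (`…QuantSliceClosure`: `slice`,
`blobLaw`, `blobMean`; `…QuantSDECBlobs`: `lconv_gate_point_eq_slice`); the `LawDec.InBlobHull` wrappers (typer g40's ✓ p407886, via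
`inBlobHull_blobLaw` + `InBlobHull.mix`) are left to the file that can import it once its olean is built.

THE SIBLING.  A 'glued pair' is the two-vertex tree `R^a[q](R^b[s])`: a root of gate `q` carrying `a ≥ 1` relays, one child of gate `s`
carrying `b ≥ 1` relays.  Its count law is `gate (slice δ_a b s) q = (1−q)·δ₀ + q(1−s)·δ_a + qs·δ_{a+b}` (`gluedPair_apply`; the sub-forest
law `δ_a ∗ gate δ_b s` is `slice δ_a b s`, `gluedPair_eq_slice`), its least marginal is `qs`, its mean `m = q(a + bs)`.  These are the
siblings of the lane's light core since README V422 (`R²[q](R s)`, 'glued root'; `a = 2, b = 1`) and of the refutations of the hull nodes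
(README V424–V426: near-sure partners `R²[u](R u)`, `R¹[u](R³[x/u])`).

THE CRITERION (law level, exact; LEAD-NOTES-G46 E9).  On its support `{0, a, a+b}` the blob hull `K_x(m)` (same-mean mixtures of
independent heavy blobs with gates in `[x,1]`, `LawDec.InBlobHull`, ✓ p407886) is spanned by at most three columns: `blob_{a+b}(m/(a+b))`,
`blob_a(m/a)` (legal iff `m ≤ a`) and `δ_a ∗ blob_b((m−a)/b)` (legal iff `(m−a)/b ≥ x`); laws on three atoms with a fixed mean form a
segment, the target has less top mass than the first column and more than the other two, so it is a member iff one of the last two is legal: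
* **`gluedPair_mix_of_slack`**: `b·(q s − x) ≥ a·(1 − q)` ('slack above the group floor `x`') ⟹ the explicit two-term certificate
  `gate (slice δ_a b s) q = w·blobLaw [(a+b, g₁)] + (1−w)·blobLaw [(a,1),(b,g₃)]` with `g₁ = m/(a+b)`, `g₃ = (m−a)/b`, `w = (1−q)(a+b)/(a+b−m)`,
  ALL of `w ∈ [0,1]`, `g₁, g₃ ∈ [x,1]`, `blobMean = m` for both lists (the hypotheses of `InBlobHull.mix` / `inBlobHull_blobLaw`);
* **`gluedPair_mix_of_le`**: `q(a + bs) ≤ a` ('light root') ⟹ `gate (slice δ_a b s) q = w·blobLaw [(a+b, g₁)] + (1−w)·blobLaw [(a, g₂)]`,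
  `g₂ = m/a ∈ [x,1]`, `w = s(a+b)/(a+bs) ∈ [0,1]`.
(The converse — no slack and a heavy root ⟹ NOT a member — is the support argument of README V424 (c); it is not needed in the kernel.)
CONSEQUENCES for the node's certificate families: a glued-pair sibling whose least marginal exceeds the group floor `x` by at least
`a(1−q)/(b)` is blob-reducible, hence FREE beside any hull member (`InBlobHull.lconv`) — in particular every NEAR-SURE glued pair (`q → 1`) at a
lower group floor (arm-1 g47 / census-2 g73 / typer g40, README V426), which is why such partners refute the hull NODES while being harmless for
`SiblingStep`; the irreducible glued pairs are exactly the NEAR-TIED heavy-rooted ones (`qs − x < a(1−q)/b`, `q(a+bs) > a`) = the light core of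
README V420–V426.  HONEST STATUS: a family lemma; `SiblingStep` / `GateStepN` / `FarTreeRow` OPEN; RATE class log\* / honest sentence unchanged.
[this work]; blob bookkeeping `blobLaw`/`slice`: prim-quant-census-2 g53; `InBlobHull` API: prim-quant-stmt g40 (this lane).  Nothing here is
cited as a published result.  The gluing rows served [cite: KozmaNitzan2024, Conjecture 3 (p. 15)]; product measure [cite: Grimmett1999, §1.3 p. 10].
-/

noncomputable section

open scoped BigOperators

namespace Summit.CriticalPhenomena.PercolationContinuityZ3.Theorems
namespace Quant
namespace LawDec

open Finset

/-- the point mass `δ_K` -/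
local notation3 "δ[" K "]" => (fun k : ℕ => if k = (K : ℕ) then (1 : ℝ) else 0)

/-! ### Pointwise values of the three laws -/

/-- a shifted point indicator: `[b ≤ h]·δ_a(h − b) = δ_{a+b}(h)`. [this work] -/
theorem shift_point_indicator (a b h : ℕ) :
    (if b ≤ h then (if h - b = a then (1 : ℝ) else 0) else 0) = if h = a + b then 1 else 0 := by
  by_cases h1 : b ≤ h
  · rw [if_pos h1]
    by_cases h2 : h - b = a
    · rw [if_pos h2, if_pos (by omega)]
    · rw [if_neg h2, if_neg (by omega)]
  · rw [if_neg h1, if_neg (by omega)]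

/-- **the count law of the glued pair `R^a[q](R^b[s])`** (`a, b ≥ 1`): `gate (slice δ_a b s) q = (1−q)δ₀ + q(1−s)δ_a + qs·δ_{a+b}`
pointwise. [this work] -/
theorem gluedPair_apply (q s : ℝ) (a b h : ℕ) (ha : 1 ≤ a) (hb : 1 ≤ b) :
    gate (slice δ[a] b s) q h
      = (if h = 0 then 1 - q else 0) + (if h = a then q * (1 - s) else 0) + (if h = a + b then q * s else 0) := by
  simp only [gate, slice]
  rw [shift_point_indicator a b h]
  by_cases h0 : h = 0
  · have h1 : ¬ h = a := by omega
    have h2 : ¬ h = a + b := by omega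
    simp only [if_pos h0, if_neg h1, if_neg h2]; ring
  · by_cases h1 : h = a
    · have h2 : ¬ h = a + b := by omega
      simp only [if_neg h0, if_pos h1, if_neg h2]; ring
    · by_cases h2 : h = a + b
      · simp only [if_neg h0, if_neg h1, if_pos h2]; ring
      · simp only [if_neg h0, if_neg h1, if_neg h2]; ring

/-- the sub-forest of the glued pair as a convolution: `δ_a ∗ gate δ_b s = slice δ_a b s` (a point law sliced by the child blob). [this work] -/
theorem gluedPair_eq_slice (s : ℝ) (a b : ℕ) : lconv a b δ[a] (gate δ[b] s) = slice δ[a] b s :=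
  lconv_gate_point_eq_slice a b δ[a] s (fun h hh => if_neg (by omega))

/-- **the law of one heavy blob** `blobLaw [(A, g)] = (1−g)δ₀ + g·δ_A` pointwise. [this work] -/
theorem blobLaw_single_apply (A : ℕ) (g : ℝ) (h : ℕ) :
    blobLaw [(A, g)] h = (if h = 0 then 1 - g else 0) + (if h = A then g else 0) := by
  simp only [blobLaw, slice]
  rw [shift_point_indicator 0 A h, Nat.zero_add]
  by_cases h0 : h = 0
  · by_cases h1 : h = A
    · simp only [if_pos h0, if_pos h1]; ring
    · simp only [if_pos h0, if_neg h1]; ring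
  · by_cases h1 : h = A
    · simp only [if_neg h0, if_pos h1]; ring
    · simp only [if_neg h0, if_neg h1]; ring

/-- **the law of a sure `a`-blob beside a `b`-blob of gate `g`** (`b ≥ 1`): `blobLaw [(a,1),(b,g)] = (1−g)δ_a + g·δ_{a+b}` pointwise.
[this work] -/
theorem blobLaw_surePair_apply (a b : ℕ) (hb : 1 ≤ b) (g : ℝ) (h : ℕ) :
    blobLaw [(a, 1), (b, g)] h = (if h = a then 1 - g else 0) + (if h = a + b then g else 0) := by
  show slice (blobLaw [(b, g)]) a 1 h = _
  simp only [slice]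
  rw [blobLaw_single_apply b g h, blobLaw_single_apply b g (h - a)]
  by_cases h1 : a ≤ h
  · rw [if_pos h1]
    by_cases h2 : h = a
    · have h3 : ¬ h = a + b := by omega
      rw [if_pos (show h - a = 0 by omega), if_neg (show ¬ h - a = b by omega), if_pos h2, if_neg h3]; ring
    · by_cases h3 : h = a + b
      · rw [if_neg (show ¬ h - a = 0 by omega), if_pos (show h - a = b by omega), if_neg h2, if_pos h3]; ring
      · rw [if_neg (show ¬ h - a = 0 by omega), if_neg (show ¬ h - a = b by omega), if_neg h2, if_neg h3]; ring
  · rw [if_neg h1, if_neg (show ¬ h = a by omega), if_neg (show ¬ h = a + b by omega)]; ring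

/-! ### The two certificates -/

/-- **SLACK ⟹ BLOB-REDUCIBLE (explicit certificate).**  For `a, b ≥ 1`, `0 < q < 1`, `0 ≤ s ≤ 1` and SLACK `a(1−q) ≤ b(qs − x)` w.r.t. any floor `x`
(the pair's least marginal `qs` exceeds the floor `x` by at least `a(1−q)/b`): with `m = q(a+bs)`, `g₁ = m/(a+b)`, `g₃ = (m−a)/b`,
`w = (1−q)(a+b)/(a+b−m)`, one has `w ∈ [0,1]`, `g₁, g₃ ∈ [x,1]`, both blob lists have mean `m`, and
`gate (slice δ_a b s) q = w·blobLaw [(a+b, g₁)] + (1−w)·blobLaw [(a,1),(b,g₃)]` pointwise — exactly the data of `InBlobHull.mix`. [this work] -/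
theorem gluedPair_mix_of_slack (x q s : ℝ) (a b : ℕ) (ha : 1 ≤ a) (hb : 1 ≤ b) (hq0 : 0 < q) (hq1 : q < 1)
    (hs0 : 0 ≤ s) (hs1 : s ≤ 1) (hslack : (a : ℝ) * (1 - q) ≤ (b : ℝ) * (q * s - x)) :
    (0 ≤ (1 - q) * ((a : ℝ) + b) / ((a : ℝ) + b - q * ((a : ℝ) + b * s)) ∧
        (1 - q) * ((a : ℝ) + b) / ((a : ℝ) + b - q * ((a : ℝ) + b * s)) ≤ 1) ∧
      (x ≤ q * ((a : ℝ) + b * s) / ((a : ℝ) + b) ∧ q * ((a : ℝ) + b * s) / ((a : ℝ) + b) ≤ 1) ∧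
      (x ≤ (q * ((a : ℝ) + b * s) - a) / (b : ℝ) ∧ (q * ((a : ℝ) + b * s) - a) / (b : ℝ) ≤ 1) ∧
      blobMean [(a + b, q * ((a : ℝ) + b * s) / ((a : ℝ) + b))] = q * ((a : ℝ) + b * s) ∧
      blobMean [(a, 1), (b, (q * ((a : ℝ) + b * s) - a) / (b : ℝ))] = q * ((a : ℝ) + b * s) ∧
      ∀ h, gate (slice δ[a] b s) q h
        = (1 - q) * ((a : ℝ) + b) / ((a : ℝ) + b - q * ((a : ℝ) + b * s)) * blobLaw [(a + b, q * ((a : ℝ) + b * s) / ((a : ℝ) + b))] h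
          + (1 - (1 - q) * ((a : ℝ) + b) / ((a : ℝ) + b - q * ((a : ℝ) + b * s)))
            * blobLaw [(a, 1), (b, (q * ((a : ℝ) + b * s) - a) / (b : ℝ))] h := by
  have ha' : (1 : ℝ) ≤ a := by exact_mod_cast ha
  have hb' : (1 : ℝ) ≤ b := by exact_mod_cast hb
  have hab0 : (0 : ℝ) < (a : ℝ) + b := by linarith
  have hb0 : (0 : ℝ) < (b : ℝ) := by linarith
  have hab0' : (a : ℝ) + b ≠ 0 := ne_of_gt hab0
  have hb0' : (b : ℝ) ≠ 0 := ne_of_gt hb0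
  -- `m ≤ q(a+b) < a+b`
  have h1 : (a : ℝ) + b * s ≤ a + b := by nlinarith
  have h2 : q * ((a : ℝ) + b * s) ≤ q * (a + b) := mul_le_mul_of_nonneg_left h1 hq0.le
  have h3 : q * ((a : ℝ) + b) < a + b := by nlinarith
  have hD : 0 < (a : ℝ) + b - q * ((a : ℝ) + b * s) := by linarith
  -- the three scalar identities behind the certificate (denominators named, so that `field_simp` clears them)
  have key0 : 1 - q = (1 - q) * ((a : ℝ) + b) / ((a : ℝ) + b - q * ((a : ℝ) + b * s))
      * (1 - q * ((a : ℝ) + b * s) / ((a : ℝ) + b)) := by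
    set D : ℝ := (a : ℝ) + b - q * ((a : ℝ) + b * s) with hDdef
    set E : ℝ := (a : ℝ) + b with hEdef
    have hD' : D ≠ 0 := ne_of_gt hD
    field_simp
    rw [hDdef]
  have key1 : q * (1 - s) = (1 - (1 - q) * ((a : ℝ) + b) / ((a : ℝ) + b - q * ((a : ℝ) + b * s)))
      * (1 - (q * ((a : ℝ) + b * s) - a) / (b : ℝ)) := by
    set D : ℝ := (a : ℝ) + b - q * ((a : ℝ) + b * s) with hDdef
    set E : ℝ := (a : ℝ) + b with hEdef
    have hD' : D ≠ 0 := ne_of_gt hD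
    field_simp
    rw [hDdef, hEdef]; ring
  have key2 : q * s = (1 - q) * ((a : ℝ) + b) / ((a : ℝ) + b - q * ((a : ℝ) + b * s)) * (q * ((a : ℝ) + b * s) / ((a : ℝ) + b))
      + (1 - (1 - q) * ((a : ℝ) + b) / ((a : ℝ) + b - q * ((a : ℝ) + b * s))) * ((q * ((a : ℝ) + b * s) - a) / (b : ℝ)) := by
    set D : ℝ := (a : ℝ) + b - q * ((a : ℝ) + b * s) with hDdef
    set E : ℝ := (a : ℝ) + b with hEdef
    have hD' : D ≠ 0 := ne_of_gt hD
    field_simp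
    rw [hDdef, hEdef]; ring
  refine ⟨⟨?_, ?_⟩, ⟨?_, ?_⟩, ⟨?_, ?_⟩, ?_, ?_, fun h => ?_⟩
  · exact div_nonneg (mul_nonneg (by linarith) hab0.le) hD.le
  · rw [div_le_one hD]; nlinarith
  · rw [le_div_iff₀ hab0]; nlinarith
  · rw [div_le_one hab0]; linarith
  · rw [le_div_iff₀ hb0]; nlinarith
  · rw [div_le_one hb0]; nlinarith
  · simp only [blobMean, Nat.cast_add, zero_add]; field_simp
  · simp only [blobMean, zero_add]; field_simp; ring
  · rw [gluedPair_apply q s a b h ha hb, blobLaw_single_apply, blobLaw_surePair_apply a b hb]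
    by_cases h0 : h = 0
    · have h1' : ¬ h = a := by omega
      have h2' : ¬ h = a + b := by omega
      simp only [if_pos h0, if_neg h1', if_neg h2']
      linear_combination key0
    · by_cases h1' : h = a
      · have h2' : ¬ h = a + b := by omega
        simp only [if_neg h0, if_pos h1', if_neg h2']
        linear_combination key1
      · by_cases h2' : h = a + b
        · simp only [if_neg h0, if_neg h1', if_pos h2']
          linear_combination key2
        · simp only [if_neg h0, if_neg h1', if_neg h2']; ring

/-- **LIGHT ROOT ⟹ BLOB-REDUCIBLE (explicit certificate).**  For `a, b ≥ 1`, `0 < x ≤ qs`, `0 < q`, `0 ≤ s ≤ 1` and `q(a + bs) ≤ a` (so `q ≤ 1`):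
with `m = q(a+bs)`, `g₁ = m/(a+b)`, `g₂ = m/a`, `w = s(a+b)/(a+bs)`, one has `w ∈ [0,1]`, `g₁, g₂ ∈ [x,1]`, both lists have mean `m`,
and `gate (slice δ_a b s) q = w·blobLaw [(a+b, g₁)] + (1−w)·blobLaw [(a, g₂)]` pointwise.  (For `a = 2`, `b = 1`: README V422's boundary
`q(2+s) ≤ 2`.) [this work] -/
theorem gluedPair_mix_of_le (x q s : ℝ) (a b : ℕ) (ha : 1 ≤ a) (hb : 1 ≤ b) (hx0 : 0 < x) (hxs : x ≤ q * s) (hq0 : 0 < q)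
    (hs0 : 0 ≤ s) (hs1 : s ≤ 1) (hle : q * ((a : ℝ) + (b : ℝ) * s) ≤ a) :
    (0 ≤ s * ((a : ℝ) + b) / ((a : ℝ) + b * s) ∧ s * ((a : ℝ) + b) / ((a : ℝ) + b * s) ≤ 1) ∧
      (x ≤ q * ((a : ℝ) + b * s) / ((a : ℝ) + b) ∧ q * ((a : ℝ) + b * s) / ((a : ℝ) + b) ≤ 1) ∧
      (x ≤ q * ((a : ℝ) + b * s) / (a : ℝ) ∧ q * ((a : ℝ) + b * s) / (a : ℝ) ≤ 1) ∧
      blobMean [(a + b, q * ((a : ℝ) + b * s) / ((a : ℝ) + b))] = q * ((a : ℝ) + b * s) ∧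
      blobMean [(a, q * ((a : ℝ) + b * s) / (a : ℝ))] = q * ((a : ℝ) + b * s) ∧
      ∀ h, gate (slice δ[a] b s) q h
        = s * ((a : ℝ) + b) / ((a : ℝ) + b * s) * blobLaw [(a + b, q * ((a : ℝ) + b * s) / ((a : ℝ) + b))] h
          + (1 - s * ((a : ℝ) + b) / ((a : ℝ) + b * s)) * blobLaw [(a, q * ((a : ℝ) + b * s) / (a : ℝ))] h := by
  have ha' : (1 : ℝ) ≤ a := by exact_mod_cast ha
  have hb' : (1 : ℝ) ≤ b := by exact_mod_cast hb
  have hab0 : (0 : ℝ) < (a : ℝ) + b := by linarith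
  have ha0 : (0 : ℝ) < (a : ℝ) := by linarith
  have hb0 : (0 : ℝ) < (b : ℝ) := by linarith
  have hP0 : (0 : ℝ) < (a : ℝ) + b * s := by nlinarith
  have hab0' : (a : ℝ) + b ≠ 0 := ne_of_gt hab0
  have ha0' : (a : ℝ) ≠ 0 := ne_of_gt ha0
  have hqs : q * s ≤ q := by nlinarith
  have hxq : x ≤ q := le_trans hxs hqs
  have e1 : x * (a : ℝ) ≤ q * (a : ℝ) := mul_le_mul_of_nonneg_right hxq ha0.le
  have e2 : x * (b : ℝ) ≤ q * s * (b : ℝ) := mul_le_mul_of_nonneg_right hxs hb0.le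
  have h1 : (a : ℝ) + b * s ≤ a + b := by nlinarith
  -- scalar identities
  have key0 : 1 - q = s * ((a : ℝ) + b) / ((a : ℝ) + b * s) * (1 - q * ((a : ℝ) + b * s) / ((a : ℝ) + b))
      + (1 - s * ((a : ℝ) + b) / ((a : ℝ) + b * s)) * (1 - q * ((a : ℝ) + b * s) / (a : ℝ)) := by
    set P : ℝ := (a : ℝ) + b * s with hPdef
    set E : ℝ := (a : ℝ) + b with hEdef
    have hP' : P ≠ 0 := ne_of_gt hP0
    field_simp
    rw [hPdef, hEdef]; ring
  have key1 : q * (1 - s) = (1 - s * ((a : ℝ) + b) / ((a : ℝ) + b * s)) * (q * ((a : ℝ) + b * s) / (a : ℝ)) := by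
    set P : ℝ := (a : ℝ) + b * s with hPdef
    set E : ℝ := (a : ℝ) + b with hEdef
    have hP' : P ≠ 0 := ne_of_gt hP0
    field_simp
    rw [hPdef, hEdef]; ring
  have key2 : q * s = s * ((a : ℝ) + b) / ((a : ℝ) + b * s) * (q * ((a : ℝ) + b * s) / ((a : ℝ) + b)) := by
    set P : ℝ := (a : ℝ) + b * s with hPdef
    set E : ℝ := (a : ℝ) + b with hEdef
    have hP' : P ≠ 0 := ne_of_gt hP0
    field_simp
  refine ⟨⟨?_, ?_⟩, ⟨?_, ?_⟩, ⟨?_, ?_⟩, ?_, ?_, fun h => ?_⟩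
  · positivity
  · rw [div_le_one hP0]; nlinarith
  · rw [le_div_iff₀ hab0]; linarith [e1, e2]
  · rw [div_le_one hab0]; nlinarith
  · rw [le_div_iff₀ ha0]; nlinarith [e1]
  · rw [div_le_one ha0]; exact hle
  · simp only [blobMean, Nat.cast_add, zero_add]; field_simp
  · simp only [blobMean, zero_add]; field_simp
  · rw [gluedPair_apply q s a b h ha hb, blobLaw_single_apply, blobLaw_single_apply]
    by_cases h0 : h = 0
    · have h1' : ¬ h = a := by omega
      have h2' : ¬ h = a + b := by omega
      simp only [if_pos h0, if_neg h1', if_neg h2']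
      linear_combination key0
    · by_cases h1' : h = a
      · have h2' : ¬ h = a + b := by omega
        simp only [if_neg h0, if_pos h1', if_neg h2']
        linear_combination key1
      · by_cases h2' : h = a + b
        · simp only [if_neg h0, if_neg h1', if_pos h2']
          linear_combination key2
        · simp only [if_neg h0, if_neg h1', if_neg h2']; ring

end LawDec
end Quant
end Summit.CriticalPhenomena.PercolationContinuityZ3.Theorems
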